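import Summits.CriticalPhenomena.PercolationContinuityZ3.Theorems.PercNearOneGluingNoHeavyLowerTailSahiThreeCopyBernstein

/-!
# `NoHeavyLowerTail` (crux stmt-CriticalPhenomena-4575), Sahi programme: **3C-SAHI WHEN TWO OF THE THREE FUNCTIONS LIVE ON
# DISJOINT COORDINATE BLOCKS (the third arbitrary)** — the partial copy swap `N_b(f;g;h) = N_b(fg;1;h)` and
# `c_b(f,g,h) = H_b(f;gh) + H_b(g;fh) ≥ 0`

Support file (Sahi cell, seat `prim-sahi-p1`, generation 55; `--supports stmt-CriticalPhenomena-4575`); companion of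
`…SahiThreeCopy` (generation 53) and `…SahiThreeCopyBlocks` (generation 54: all THREE slots are products over the blocks).

THE CLASS.  `f` depends only on the coordinates in `T ⊆ [d]`, `g` only on the coordinates outside `T` (`DependsOn`), and
`h` is an ARBITRARY nonnegative monotone function of all coordinates.  At law level this case of Sahi's conjecture is two lines
(`E₃ = Cov(f,gh) + Cov(g,fh) − E[h]·Cov(f,g)` and `Cov(f,g) = 0` for independent `f, g`); coefficientwise (3C-SAHI, the
census's tensor-Bernstein form, CENSUS §175 / W197) the vanishing of the third bracket `H_b(f,g | h) = N_b(fg;h;1) − N_b(f;g;h)`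
is NOT termwise — it is the PARTIAL COPY SWAP proved here: exchanging the first two copies on the coordinates outside `T` only
is a bijection of the arrangements of every profile `b` (the arrangement condition is per coordinate), it fixes `f(x)` and
turns `g(y)` into `g(x)`:
* `mixPt`, `mixEquiv` — the swap `(x,y) ↦ ((x|_T, y|_{Tᶜ}), (y|_T, x|_{Tᶜ}))`, an involution of `Pt d × Pt d` preserving
  `IsArr b · · z`;
* `N3_eq_of_dependsOn` — **`N_b(f;g;h) = N_b(fg;1;h)`** for `f` `T`-measurable, `g` `Tᶜ`-measurable, ANY `h` and every `b`
  (so also `H_b(f,g | h) = 0`: coefficientwise, block-independent functions are uncorrelated under every spectator);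
* `tc_eq_two_harris_of_dependsOn` — `c_b(f,g,h) = [N_b(fgh;1;1) − N_b(f;gh;1)] + [N_b(fgh;1;1) − N_b(g;fh;1)]`;
* **`tc_nonneg_of_dependsOn`** — `0 ≤ c_b(f,g,h)` for nonnegative monotone `f, g, h` with `f, g` on disjoint blocks (two
  three-copy Harris gaps), with the slot permutations `tc_nonneg_of_dependsOn₁₃`, `tc_nonneg_of_dependsOn₂₃`, the events form
  `tc_setInd_nonneg_of_dependsOn`, and the law-level corollary `sahiE_three_coin_nonneg_of_dependsOn` (`E₃^{coin q} ≥ 0`).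
This class is not contained in the read-once closure of generation 54 (`h` is unrestricted) nor in the nested/principal classes.
Nothing conjectural is used or asserted.  [this work]
-/

namespace Summit.CriticalPhenomena.PercolationContinuityZ3.Theorems.SahiThreeCopy

open Finset Function Literature.Combinatorics.Sahi2008
open scoped BigOperators

noncomputable section

variable {d : ℕ}

/-! ### §1 Block-measurable functions and the partial copy swap -/

/-- `f` DEPENDS ONLY ON the coordinates in `T`: points agreeing on `T` have the same value. [this work] -/
def DependsOn (f : Pt d → ℝ) (T : Finset (Fin d)) : Prop := ∀ x y : Pt d, (∀ i ∈ T, x i = y i) → f x = f y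

/-- The mixed point `(x|_T, y|_{Tᶜ})`: coordinates in `T` from `x`, the others from `y`. [this work] -/
def mixPt (T : Finset (Fin d)) (x y : Pt d) : Pt d := fun i => if i ∈ T then x i else y i

/-- On `T` the mixed point agrees with `x`. [this work] -/
theorem mixPt_of_mem (T : Finset (Fin d)) (x y : Pt d) {i : Fin d} (hi : i ∈ T) : mixPt T x y i = x i := by
  unfold mixPt; rw [if_pos hi]

/-- Off `T` the mixed point agrees with `y`. [this work] -/
theorem mixPt_of_not_mem (T : Finset (Fin d)) (x y : Pt d) {i : Fin d} (hi : i ∉ T) : mixPt T x y i = y i := by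
  unfold mixPt; rw [if_neg hi]

/-- Mixing twice returns the original pair (first component). [this work] -/
theorem mixPt_mixPt_left (T : Finset (Fin d)) (x y : Pt d) : mixPt T (mixPt T x y) (mixPt T y x) = x := by
  funext i; unfold mixPt; split_ifs <;> rfl

/-- Mixing twice returns the original pair (second component). [this work] -/
theorem mixPt_mixPt_right (T : Finset (Fin d)) (x y : Pt d) : mixPt T (mixPt T y x) (mixPt T x y) = y := by
  funext i; unfold mixPt; split_ifs <;> rfl

/-- The PARTIAL COPY SWAP on pairs of points: `(x,y) ↦ ((x|_T,y|_{Tᶜ}), (y|_T,x|_{Tᶜ}))`, an involution. [this work] -/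
def mixEquiv (T : Finset (Fin d)) : Pt d × Pt d ≃ Pt d × Pt d where
  toFun p := (mixPt T p.1 p.2, mixPt T p.2 p.1)
  invFun p := (mixPt T p.1 p.2, mixPt T p.2 p.1)
  left_inv p := by
    rcases p with ⟨x, y⟩
    simp only [mixPt_mixPt_left]
  right_inv p := by
    rcases p with ⟨x, y⟩
    simp only [mixPt_mixPt_left]

/-- The partial copy swap preserves the arrangement condition (it is coordinatewise, and `x_i + y_i = y_i + x_i`). [this work] -/
theorem isArr_mixPt_iff (b : Fin d → ℕ) (T : Finset (Fin d)) (x y z : Pt d) :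
    IsArr b (mixPt T x y) (mixPt T y x) z ↔ IsArr b x y z := by
  unfold IsArr
  refine forall_congr' fun i => ?_
  by_cases hi : i ∈ T
  · rw [mixPt_of_mem T x y hi, mixPt_of_mem T y x hi]
  · rw [mixPt_of_not_mem T x y hi, mixPt_of_not_mem T y x hi]
    constructor <;> intro h <;> omega

/-- A `T`-measurable function does not see the swap in the first copy: `f(x|_T, y|_{Tᶜ}) = f(x)`. [this work] -/
theorem dependsOn_mixPt_left {f : Pt d → ℝ} {T : Finset (Fin d)} (hf : DependsOn f T) (x y : Pt d) :
    f (mixPt T x y) = f x :=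
  hf _ _ fun _ hi => mixPt_of_mem T x y hi

/-- A `Tᶜ`-measurable function sees the FIRST copy after the swap in the second copy: `g(y|_T, x|_{Tᶜ}) = g(x)`. [this work] -/
theorem dependsOn_compl_mixPt_right {g : Pt d → ℝ} {T : Finset (Fin d)} (hg : DependsOn g (univ \ T)) (x y : Pt d) :
    g (mixPt T y x) = g x :=
  hg _ _ fun _ hi => mixPt_of_not_mem T y x (Finset.mem_sdiff.1 hi).2

/-! ### §2 `N_b(f;g;h) = N_b(fg;1;h)` for block-independent `f, g` -/

/-- Merging the first two point sums of `N_b` into a sum over pairs. [this work] -/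
theorem N3_eq_sum_prod (b : Fin d → ℕ) (f g h : Pt d → ℝ) :
    N3 b f g h = ∑ p : Pt d × Pt d, ∑ z : Pt d, if IsArr b p.1 p.2 z then f p.1 * g p.2 * h z else 0 := by
  unfold N3
  rw [← Finset.sum_product']
  rfl

/-- **The partial copy swap identity**: if `f` depends only on the coordinates in `T` and `g` only on those outside `T`,
then for EVERY `h` and every profile `b`, `N_b(f;g;h) = N_b(fg;1;h)` — splitting the block-independent pair over two copies
or putting it on one copy gives the same three-copy count. [this work] -/
theorem N3_eq_of_dependsOn (b : Fin d → ℕ) {f g : Pt d → ℝ} {T : Finset (Fin d)} (hf : DependsOn f T)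
    (hg : DependsOn g (univ \ T)) (h : Pt d → ℝ) : N3 b f g h = N3 b (f * g) 1 h := by
  rw [N3_eq_sum_prod, N3_eq_sum_prod, ← Equiv.sum_comp (mixEquiv T)]
  refine Finset.sum_congr rfl fun p _ => Finset.sum_congr rfl fun z _ => ?_
  rcases p with ⟨x, y⟩
  show (if IsArr b (mixPt T x y) (mixPt T y x) z then f (mixPt T x y) * g (mixPt T y x) * h z else 0) =
    if IsArr b x y z then (f * g) x * (1 : Pt d → ℝ) y * h z else 0
  rw [if_congr (isArr_mixPt_iff b T x y z) rfl rfl, dependsOn_mixPt_left hf, dependsOn_compl_mixPt_right hg]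
  simp only [Pi.mul_apply, Pi.one_apply, mul_one]

/-- Hence the spectator-Harris gap of a block-independent pair VANISHES coefficientwise: `N_b(fg;h;1) − N_b(f;g;h) = 0`. [this work] -/
theorem harrisGap_eq_zero_of_dependsOn (b : Fin d → ℕ) {f g : Pt d → ℝ} {T : Finset (Fin d)} (hf : DependsOn f T)
    (hg : DependsOn g (univ \ T)) (h : Pt d → ℝ) : N3 b (f * g) h 1 - N3 b f g h = 0 := by
  rw [N3_eq_of_dependsOn b hf hg h, N3_comm23, sub_self]

/-! ### §3 3C-SAHI for a block-independent pair and an arbitrary third function -/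

/-- For a block-independent pair `(f,g)` and any `h`:
`c_b(f,g,h) = [N_b(fgh;1;1) − N_b(f;gh;1)] + [N_b(fgh;1;1) − N_b(g;fh;1)]` (the third Harris bracket of `tc_eq_harris_sub`
vanishes). [this work] -/
theorem tc_eq_two_harris_of_dependsOn (b : Fin d → ℕ) {f g : Pt d → ℝ} {T : Finset (Fin d)} (hf : DependsOn f T)
    (hg : DependsOn g (univ \ T)) (h : Pt d → ℝ) :
    tc b f g h = (N3 b (f * g * h) 1 1 - N3 b f (g * h) 1) + (N3 b (f * g * h) 1 1 - N3 b g (f * h) 1) := by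
  rw [tc_eq_harris_sub, harrisGap_eq_zero_of_dependsOn b hf hg h, sub_zero]

/-- **3C-SAHI for a block-independent pair.**  If `f` depends only on the coordinates in `T`, `g` only on those outside `T`,
and `f, g, h` are nonnegative monotone (`h` ARBITRARY otherwise), then `0 ≤ c_b(f,g,h)` for every profile `b`: two three-copy
Harris gaps (`f` against `gh`, `g` against `fh`). [this work] -/
theorem tc_nonneg_of_dependsOn (b : Fin d → ℕ) {f g h : Pt d → ℝ} {T : Finset (Fin d)} (hfT : DependsOn f T)
    (hgT : DependsOn g (univ \ T)) (hf : ∀ x, 0 ≤ f x) (hfm : Monotone f) (hg : ∀ x, 0 ≤ g x) (hgm : Monotone g)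
    (hh : ∀ x, 0 ≤ h x) (hhm : Monotone h) : 0 ≤ tc b f g h := by
  rw [tc_eq_two_harris_of_dependsOn b hfT hgT h]
  have one_nn : ∀ x : Pt d, (0 : ℝ) ≤ (1 : Pt d → ℝ) x := fun _ => zero_le_one
  have H1 := N3_le_N3_mul d b f (g * h) 1 hf hfm (fun x => mul_nonneg (hg x) (hh x)) (hgm.mul hhm hg hh) one_nn
  have H2 := N3_le_N3_mul d b g (f * h) 1 hg hgm (fun x => mul_nonneg (hf x) (hh x)) (hfm.mul hhm hf hh) one_nn
  have e1 : f * (g * h) = f * g * h := (mul_assoc f g h).symm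
  have e2 : g * (f * h) = f * g * h := by rw [mul_left_comm, mul_assoc]
  rw [e1] at H1; rw [e2] at H2
  linarith

/-- Slots 1 and 3 block-independent, slot 2 arbitrary. [this work] -/
theorem tc_nonneg_of_dependsOn₁₃ (b : Fin d → ℕ) {f g h : Pt d → ℝ} {T : Finset (Fin d)} (hfT : DependsOn f T)
    (hhT : DependsOn h (univ \ T)) (hf : ∀ x, 0 ≤ f x) (hfm : Monotone f) (hg : ∀ x, 0 ≤ g x) (hgm : Monotone g)
    (hh : ∀ x, 0 ≤ h x) (hhm : Monotone h) : 0 ≤ tc b f g h := by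
  rw [tc_comm23]
  exact tc_nonneg_of_dependsOn b hfT hhT hf hfm hh hhm hg hgm

/-- Slots 2 and 3 block-independent, slot 1 arbitrary. [this work] -/
theorem tc_nonneg_of_dependsOn₂₃ (b : Fin d → ℕ) {f g h : Pt d → ℝ} {T : Finset (Fin d)} (hgT : DependsOn g T)
    (hhT : DependsOn h (univ \ T)) (hf : ∀ x, 0 ≤ f x) (hfm : Monotone f) (hg : ∀ x, 0 ≤ g x) (hgm : Monotone g)
    (hh : ∀ x, 0 ≤ h x) (hhm : Monotone h) : 0 ≤ tc b f g h := by
  rw [tc_comm12, tc_comm23]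
  exact tc_nonneg_of_dependsOn b hgT hhT hg hgm hh hhm hf hfm

/-- Events form: up-sets `A, B, C` with membership in `A` decided by the coordinates in `T` and membership in `B` by the
coordinates outside `T` (`C` arbitrary): `0 ≤ c_b(1_A,1_B,1_C)`. [this work] -/
theorem tc_setInd_nonneg_of_dependsOn (b : Fin d → ℕ) {A B C : Finset (Pt d)} {T : Finset (Fin d)}
    (hAT : DependsOn (setInd A) T) (hBT : DependsOn (setInd B) (univ \ T)) (hA : IsUpperSet (A : Set (Pt d)))
    (hB : IsUpperSet (B : Set (Pt d))) (hC : IsUpperSet (C : Set (Pt d))) :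
    0 ≤ tc b (setInd A) (setInd B) (setInd C) :=
  tc_nonneg_of_dependsOn b hAT hBT (setInd_nonneg A) (monotone_setInd hA) (setInd_nonneg B) (monotone_setInd hB)
    (setInd_nonneg C) (monotone_setInd hC)

/-- Law level: `E₃^{coin q}(f,g,h) ≥ 0` for every product measure when `f, g` are block-independent nonnegative monotone and
`h` is any nonnegative monotone function (Sahi's `C₃` for this class, via Bernstein positivity). [this work] -/
theorem sahiE_three_coin_nonneg_of_dependsOn {q : Fin d → ℝ} (hq : ∀ i, 0 ≤ q i ∧ q i ≤ 1) {f g h : Pt d → ℝ}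
    {T : Finset (Fin d)} (hfT : DependsOn f T) (hgT : DependsOn g (univ \ T)) (hf : ∀ x, 0 ≤ f x) (hfm : Monotone f)
    (hg : ∀ x, 0 ≤ g x) (hgm : Monotone g) (hh : ∀ x, 0 ≤ h x) (hhm : Monotone h) :
    0 ≤ sahiE (coinWeight q) 3 ![f, g, h] :=
  sahiE_three_coin_nonneg_of_tc hq fun b => tc_nonneg_of_dependsOn b hfT hgT hf hfm hg hgm hh hhm

end

end Summit.CriticalPhenomena.PercolationContinuityZ3.Theorems.SahiThreeCopy
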